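import Summits.Ventures.CertifiedArithmetic.Expansions.Orient2dBlocks
import Summits.Ventures.CertifiedArithmetic.Expansions.WeakExpansionScale
import Literature.ComputerArithmetic.Shewchuk1997.Orient2dStageA
import Mathlib.Tactic.Linarith
import Mathlib.Tactic.Ring
import Mathlib.Tactic.NormNum

/-!
# ORIENT3D, stage B: the exact expansion over the computed differences is a W-expansion

NEW WORK in the sense of this development (the algorithm is Shewchuk's; definitions over `ℚ`,
statements and proofs are ours; nothing here is cited anywhere as a literature fact).

THE OBJECT.  ORIENT3D(a, b, c, d) is the sign of
`(7) = |a−d; b−d; c−d| = Σ_cyclic (a_z − d_z)·((b_x − d_x)(c_y − d_y) − (c_x − d_x)(b_y − d_y))`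
[Shewchuk1997, §4.2 p. 345, §4.4 pp. 350–352].  After the floating-point filter (stage A,
`Literature/…/Shewchuk1997/Orient3dStageA.lean`) fails, the adaptive routine computes the nine
differences `x_a = a_x ⊖ d_x, …, z_c = c_z ⊖ d_z` in floating point and then EXACTLY, in expansion
arithmetic, the determinant of these COMPUTED differences,
`B = z_a·(x_b·y_c − x_c·y_b) + z_b·(x_c·y_a − x_a·y_c) + z_c·(x_a·y_b − x_b·y_a)`  (`orient3dDetB`):
each 2×2 minor as the four-component block TWO-TWO-DIFF of two error-free TWO-PRODUCTs
(`twoTwoProdDiff`, `Orient2dBlocks.lean`), each cofactor term by SCALE-EXPANSION of that block by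
the `z`-difference with zero elimination (`scaleExpansionZeroElim`, ≤ 8 components), and the sum of
the three terms by two FAST-EXPANSION-SUMs with zero elimination (≤ 16, ≤ 24 components).  Stage B
then returns `estimate` of this expansion if it passes the test of Table 3, line B
(`(3ε + 28ε²) ⊗ permanent`); stages C–D refine it with the tails of the differences.  This is the
structure of `predicates.c`'s `orient3dadapt` (arrays `bc, ca, ab`, `adet, bdet, cdet`, `abdet`,
`fin1`); the paper describes it in prose only (p. 350: "the computation is performed by the
technique of §4.3", Table 3).  We do not hold the text of `predicates.c`; the definition below is
our transcription of that structure and is what the theorems are about — nothing is claimed about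
the C code itself (as everywhere in this library: exact model over `ℚ`, abstract round-to-nearest
`fl` into `F(p, emin)`, an abstract two-product `tp`, no overflow).

THE RESULTS.
* `scaleExpansionZeroElim_spec` — SCALE-EXPANSION followed by zero elimination maps a weakly
  nonoverlapping expansion of floats to a NONEMPTY weakly nonoverlapping expansion of floats with
  sum `b·Σe`, all components nonzero unless it is `⟨0⟩`, length `≤ max 2m 1` (Theorem 3 of this
  development, `WeakExpansionScale.lean`, plus `zeroElim`; `p ≥ 1`, `RoundoffBelow 2` rounding, the
  no-underflow model of `ScaleExpansion.lean`).
* `twoTwoProdDiff_coarse` — on factors in `F(p, e₀)` with `2e₀ ≥ emin` the block's components lie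
  in `F(p, 2e₀)` (they are floats on the grid `2^(2e₀)·ℤ`).
* `orient3dTerm_spec` — one cofactor term `z ⊗ ⟨block⟩`: a W-expansion of `≤ 8` floats with sum
  `z·(ab − cd)`, for factors and `z` in `F(p, e₀)`, `2e₀ ≥ emin`, `3e₀ ≥ emin` (no product of three
  coordinates' worth of magnitude underflows) and error-free two-products on `F(p, e₀)²` and on
  `F(p, 2e₀) × F(p, e₀)`.
* **`orient3dB_spec`** — for `p ≥ 4`, a round-to-nearest with `RoundoffBelow 2` (e.g. ties-to-even)
  and nine differences in `F(p, e₀)` as above: `orient3dB` is a NONEMPTY weakly nonoverlapping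
  expansion of `≤ 24` floats, all nonzero unless it is `⟨0⟩`, with `Σ = orient3dDetB` EXACTLY;
  `orient3dB_sign` — its last component has the sign of `B` and `B = 0 ↔ orient3dB = ⟨0⟩`.
* Instances of the two-product hypotheses: `exactTwoProd_twoProdFMA₂` (FMA, formats `e₁, e₀`
  with `e₁ + e₀ ≥ emin`) and `exactTwoProd_twoProduct₂` (Dekker/Shewchuk TWO-PRODUCT with split
  point `s`, `p ≤ 2s ≤ p + 1`, rounding odd, `e₁, e₀ ≥ emin + p − 1`, `e₁ + e₀ ≥ emin + 2p − 1`);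
  `orient3dB_fma_spec`, `orient3dB_dekker_spec`.
What is NOT here: the link `x_a = a_x ⊖ d_x` to input coordinates and the tails (stage C–D), the
stage-B error bound and test (they need `|estimate − Σ| ≤ 3u|Σ|` on W-expansions,
`EstimateRelativeError.lean`, and the perturbation bound `|(7) − B| ≤ (3ε + 3ε² + ε³)·Π`), INCIRCLE.

No separate numerical evidence was gathered for this file: the theorems compose the landed block
lemma (`twoTwoProdDiff_spec`), Theorem 3 (`scaleExpansion_isWeakExpansion`) and Theorems 1–2
(`fastExpansionSumZeroElim_spec`), each of which came with its own exhaustive / sampled evidence.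
The only other ORIENT3D file in the tree is the stage-A filter; ORIENT2D's stage B
(`Orient2dStageB*.lean`) has a single four-component block and no SCALE-EXPANSION.

Reference for the algorithm: J. R. Shewchuk, Discrete Comput. Geom. 18 (1997) 305–363, §4.4 and
`predicates.c` (`orient3dadapt`) [Shewchuk1997].
-/

namespace Summit.Ventures.CertifiedArithmetic.Expansions

open Literature.ComputerArithmetic.JeannerodRump2018
open Literature.ComputerArithmetic.BoldoJeannerodMelquiondMuller2023 hiding twoSum twoSum_fst
  isFloat_twoSum
open Literature.ComputerArithmetic.Shewchuk1997

variable {p : ℕ} {emin : ℤ} {fl : ℚ → ℚ}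

/-! ## SCALE-EXPANSION with zero elimination -/

/-- **SCALE-EXPANSION WITH ZERO ELIMINATION** (`scale_expansion_zeroelim` of `predicates.c`),
modelled as the tree's SCALE-EXPANSION followed by `zeroElim` (the C routine drops zero components
on the fly and keeps the last one if all are zero — the same list). -/
def scaleExpansionZeroElim (tp : ℚ → ℚ → ℚ × ℚ) (fl : ℚ → ℚ) (e : List ℚ) (b : ℚ) : List ℚ :=
  zeroElim (scaleExpansion tp fl e b)

/-- SCALE-EXPANSION-ZEROELIM maps a weakly nonoverlapping expansion of floats to a NONEMPTY weakly
nonoverlapping expansion of floats with sum `b·Σe`, all of whose components are nonzero unless it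
is `⟨0⟩`, of length `≤ max 2m 1` — Theorem 3 of this development plus zero elimination
(hypotheses of `scaleExpansion_isWeakExpansion`: `p ≥ 1`, `RoundoffBelow 2`, `b = M_b·2^kb`,
components in `F(p, emin) ∩ F(p, emin − kb)`, exact two-products `eᵢ ⊗ b`). -/
theorem scaleExpansionZeroElim_spec (hp : 1 ≤ p) (hfl : IsRoundNearest p emin fl)
    (hfl2 : RoundoffBelow 2 fl) {tp : ℚ → ℚ → ℚ × ℚ} {e : List ℚ} {b : ℚ} {Mb kb : ℤ}
    (hbrep : b = (Mb : ℚ) * 2 ^ kb) (hMb : |Mb| < 2 ^ p)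
    (he : ∀ x ∈ e, IsFloat p emin x) (heU : ∀ x ∈ e, IsFloat p (emin - kb) x)
    (hexp : IsWeakExpansion e)
    (htp : ∀ x ∈ e, (tp x b).1 = fl (x * b) ∧ (tp x b).1 + (tp x b).2 = x * b) :
    IsWeakExpansion (scaleExpansionZeroElim tp fl e b) ∧
      (scaleExpansionZeroElim tp fl e b).sum = e.sum * b ∧
      (∀ z ∈ scaleExpansionZeroElim tp fl e b, IsFloat p emin z) ∧
      scaleExpansionZeroElim tp fl e b ≠ [] ∧
      ((∀ z ∈ scaleExpansionZeroElim tp fl e b, z ≠ 0) ∨ scaleExpansionZeroElim tp fl e b = [0]) ∧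
      (scaleExpansionZeroElim tp fl e b).length ≤ max (2 * e.length) 1 := by
  obtain ⟨hW, hS, hF, hL⟩ := scaleExpansion_isWeakExpansion hp hfl hfl2 hbrep hMb he heU hexp htp
  unfold scaleExpansionZeroElim
  refine ⟨isWeakExpansion_zeroElim hW, by rw [sum_zeroElim, hS], fun z hz => ?_, zeroElim_ne_nil _,
    zeroElim_nonzero_or _, by rw [← hL]; exact length_zeroElim_le _⟩
  rcases mem_zeroElim hz with ⟨hz, -⟩ | rfl
  · exact hF z hz
  · exact isFloat_zero p emin

/-! ## Error-free two-products across two formats -/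

/-- **FMA TWO-PRODUCT, two formats**: for `x ∈ F(p, e₁)`, `y ∈ F(p, e₀)` with `e₁ + e₀ ≥ emin` the
product does not underflow and `2Prod_FMA` is error-free. -/
theorem exactTwoProd_twoProdFMA₂ (hp : 1 ≤ p) (hfl : IsRoundNearest p emin fl) {e₁ e₀ : ℤ}
    (h2 : emin ≤ e₁ + e₀) {x y : ℚ} (hx : IsFloat p e₁ x) (hy : IsFloat p e₀ y) :
    ExactTwoProd p emin fl (twoProdFMA fl) x y := by
  obtain ⟨Mx, ex, hMx, hex, rfl⟩ := hx
  obtain ⟨My, ey, hMy, hey, rfl⟩ := hy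
  obtain ⟨-, hsum⟩ := twoProdFMA_correct hp hfl hMx hMy (by omega : emin ≤ ex + ey)
  exact ⟨rfl, hsum, (hfl _).1⟩

/-- **DEKKER / SHEWCHUK TWO-PRODUCT, two formats** (Theorem 18 with `p ≤ 2s ≤ p + 1`, `p ≥ 4`,
rounding commuting with negation): error-free on `F(p, e₁) × F(p, e₀)` as soon as
`e₁, e₀ ≥ emin + p − 1` and `e₁ + e₀ ≥ emin + 2p − 1`. -/
theorem exactTwoProd_twoProduct₂ (hp : 4 ≤ p) {s : ℕ} (hs2 : p ≤ 2 * s) (hs2' : 2 * s ≤ p + 1)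
    (hfl : IsRoundNearest p emin fl) (hodd : ∀ t, fl (-t) = -fl t) {e₁ e₀ : ℤ}
    (h1 : emin + p - 1 ≤ e₁) (h1' : emin + p - 1 ≤ e₀) (h2 : emin + 2 * p - 1 ≤ e₁ + e₀)
    {x y : ℚ} (hx : IsFloat p e₁ x) (hy : IsFloat p e₀ y) :
    ExactTwoProd p emin fl (twoProduct fl s) x y := by
  have hp1 : 1 ≤ p := le_trans (by norm_num) hp
  have hxy : x * y = 0 ∨ ((2 : ℚ) ^ (emin + p - 1) ≤ |x| ∧ (2 : ℚ) ^ (emin + p - 1) ≤ |y| ∧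
      (2 : ℚ) ^ (emin + 2 * p - 1) ≤ |x * y|) := by
    by_cases hx0 : x = 0
    · left; simp [hx0]
    by_cases hy0 : y = 0
    · left; simp [hy0]
    right
    have gx : (2 : ℚ) ^ e₁ ≤ |x| := (OnGrid.of_isFloat hx).two_zpow_le_abs hx0
    have gy : (2 : ℚ) ^ e₀ ≤ |y| := (OnGrid.of_isFloat hy).two_zpow_le_abs hy0
    refine ⟨(zpow_le_zpow_right₀ (by norm_num) h1).trans gx,
      (zpow_le_zpow_right₀ (by norm_num) h1').trans gy, ?_⟩
    rw [abs_mul]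
    calc (2 : ℚ) ^ (emin + 2 * p - 1) ≤ (2 : ℚ) ^ (e₁ + e₀) := zpow_le_zpow_right₀ (by norm_num) h2
      _ = (2 : ℚ) ^ e₁ * (2 : ℚ) ^ e₀ := zpow_add₀ (by norm_num) _ _
      _ ≤ |x| * |y| := mul_le_mul gx gy (zpow_nonneg (by norm_num) _) (abs_nonneg x)
  obtain ⟨hfst, hsum, hF, -, -⟩ := twoProduct_spec hp hs2 hs2' hfl hodd (roundoffBelow_one hp1 hfl)
    (isFloat_of_emin_le (by omega) hx) (isFloat_of_emin_le (by omega) hy) hxy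
  exact ⟨hfst, hsum, hF⟩

/-! ## The block on a coarse format -/

/-- On factors in `F(p, e₀)` with `2e₀ ≥ emin`, the components of the block TWO-TWO-DIFF of two
error-free two-products are floats on the grid `2^(2e₀)·ℤ`, i.e. members of `F(p, 2e₀)`. -/
theorem twoTwoProdDiff_coarse (hp : 1 ≤ p) (hfl : IsRoundNearest p emin fl)
    (hfl2 : RoundoffBelow 2 fl) {e₀ : ℤ} (h2 : emin ≤ e₀ + e₀) {tp : ℚ → ℚ → ℚ × ℚ}
    {a b c d : ℚ} (ha : IsFloat p e₀ a) (hb : IsFloat p e₀ b) (hc : IsFloat p e₀ c)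
    (hd : IsFloat p e₀ d) (hab : ExactTwoProd p emin fl tp a b)
    (hcd : ExactTwoProd p emin fl tp c d) :
    ∀ x ∈ twoTwoProdDiff tp fl a b c d, IsFloat p (e₀ + e₀) x := by
  obtain ⟨-, -, -, hF⟩ := twoTwoProdDiff_spec hp hfl hfl2 hab hcd
  obtain ⟨h1, hs1, hF1⟩ := hab
  obtain ⟨h2', hs2, hF2⟩ := hcd
  have gab : OnGrid (e₀ + e₀) (a * b) := (OnGrid.of_isFloat ha).mul (OnGrid.of_isFloat hb)
  have gcd : OnGrid (e₀ + e₀) (c * d) := (OnGrid.of_isFloat hc).mul (OnGrid.of_isFloat hd)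
  have ghi1 : OnGrid (e₀ + e₀) (tp a b).1 := by rw [h1]; exact gab.fl_of hp hfl h2
  have ghi2 : OnGrid (e₀ + e₀) (tp c d).1 := by rw [h2']; exact gcd.fl_of hp hfl h2
  have glo1 : OnGrid (e₀ + e₀) (tp a b).2 := by
    have : (tp a b).2 = a * b - (tp a b).1 := by linarith
    rw [this]; exact gab.sub ghi1
  have glo2 : OnGrid (e₀ + e₀) (tp c d).2 := by
    have : (tp c d).2 = c * d - (tp c d).1 := by linarith
    rw [this]; exact gcd.sub ghi2
  have hhi1 : IsFloat p emin (tp a b).1 := h1 ▸ (hfl _).1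
  have hhi2 : IsFloat p emin (tp c d).1 := h2' ▸ (hfl _).1
  have he : ∀ x ∈ [(tp a b).2, (tp a b).1], IsFloat p emin x := forall_mem_pair hF1 hhi1
  have hf : ∀ x ∈ [-(tp c d).2, -(tp c d).1], IsFloat p emin x :=
    forall_mem_pair hF2.neg hhi2.neg
  have heG : ∀ x ∈ [(tp a b).2, (tp a b).1], OnGrid (e₀ + e₀) x := forall_mem_pair glo1 ghi1
  have hfG : ∀ x ∈ [-(tp c d).2, -(tp c d).1], OnGrid (e₀ + e₀) x :=
    forall_mem_pair glo2.neg ghi2.neg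
  have hG := onGrid_of_mem_expansionSum hp hfl h2 he hf heG hfG
  intro x hx
  exact isFloat_of_isFloat_of_onGrid (hF x hx) (hG x hx)

/-! ## ORIENT3D, stage B -/

/-- One cofactor term of stage B: the block `⟨a ⊗ b − c ⊗ d⟩` (four components, exact) scaled by
`z` with SCALE-EXPANSION-ZEROELIM — `predicates.c`: `Two_Product; Two_Product; Two_Two_Diff;
scale_expansion_zeroelim(4, bc, adz, adet)`. -/
def orient3dTerm (tp : ℚ → ℚ → ℚ × ℚ) (fl : ℚ → ℚ) (a b c d z : ℚ) : List ℚ :=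
  scaleExpansionZeroElim tp fl (twoTwoProdDiff tp fl a b c d) z

/-- The determinant of the nine COMPUTED differences (cofactor expansion along the `z` column, the
minors written as `predicates.c` writes them: `bc = x_b·y_c − x_c·y_b`, `ca = x_c·y_a − x_a·y_c`,
`ab = x_a·y_b − x_b·y_a`). -/
def orient3dDetB (xa ya za xb yb zb xc yc zc : ℚ) : ℚ :=
  za * (xb * yc - xc * yb) + zb * (xc * ya - xa * yc) + zc * (xa * yb - xb * ya)

/-- **STAGE B OF ORIENT3D, the expansion** (`predicates.c` `orient3dadapt`: `adet = bc ⊗ z_a`,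
`bdet = ca ⊗ z_b`, `cdet = ab ⊗ z_c`, `abdet = adet ⊞ bdet`, `fin1 = abdet ⊞ cdet`, all with zero
elimination), over a two-product `tp` and a rounding `fl`; arguments = the nine computed
differences `x_a, y_a, z_a, x_b, …, z_c`. -/
def orient3dB (tp : ℚ → ℚ → ℚ × ℚ) (fl : ℚ → ℚ) (xa ya za xb yb zb xc yc zc : ℚ) : List ℚ :=
  fastExpansionSumZeroElim fl
    (fastExpansionSumZeroElim fl (orient3dTerm tp fl xb yc xc yb za)
      (orient3dTerm tp fl xc ya xa yc zb))
    (orient3dTerm tp fl xa yb xb ya zc)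

/-- **One cofactor term is an exact W-expansion of ≤ 8 floats.**  `p ≥ 1`, `RoundoffBelow 2`
round-to-nearest, factors and `z` in `F(p, e₀)` with `2e₀ ≥ emin` and `3e₀ ≥ emin`, error-free
two-products on `F(p, e₀)²` (the block) and on `F(p, 2e₀) × F(p, e₀)` (the scaling): then
`orient3dTerm` is a nonempty W-expansion of floats with `Σ = z·(ab − cd)`, components nonzero unless
`⟨0⟩`, length `≤ 8`. -/
theorem orient3dTerm_spec (hp : 1 ≤ p) (hfl : IsRoundNearest p emin fl) (hfl2 : RoundoffBelow 2 fl)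
    {e₀ : ℤ} (h2 : emin ≤ e₀ + e₀) (h3 : emin ≤ e₀ + e₀ + e₀) {tp : ℚ → ℚ → ℚ × ℚ}
    (htp : ∀ x y, IsFloat p e₀ x → IsFloat p e₀ y → ExactTwoProd p emin fl tp x y)
    (htp' : ∀ x y, IsFloat p (e₀ + e₀) x → IsFloat p e₀ y → ExactTwoProd p emin fl tp x y)
    {a b c d z : ℚ} (ha : IsFloat p e₀ a) (hb : IsFloat p e₀ b) (hc : IsFloat p e₀ c)
    (hd : IsFloat p e₀ d) (hz : IsFloat p e₀ z) :
    IsWeakExpansion (orient3dTerm tp fl a b c d z) ∧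
      (orient3dTerm tp fl a b c d z).sum = z * (a * b - c * d) ∧
      (∀ x ∈ orient3dTerm tp fl a b c d z, IsFloat p emin x) ∧
      orient3dTerm tp fl a b c d z ≠ [] ∧
      ((∀ x ∈ orient3dTerm tp fl a b c d z, x ≠ 0) ∨ orient3dTerm tp fl a b c d z = [0]) ∧
      (orient3dTerm tp fl a b c d z).length ≤ 8 := by
  obtain ⟨WB, SB, LB, FB⟩ := twoTwoProdDiff_spec hp hfl hfl2 (htp _ _ ha hb) (htp _ _ hc hd)
  have GB := twoTwoProdDiff_coarse hp hfl hfl2 h2 ha hb hc hd (htp _ _ ha hb) (htp _ _ hc hd)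
  obtain ⟨Mb, kb, hMb, hkb, hrep⟩ := hz
  have heU : ∀ x ∈ twoTwoProdDiff tp fl a b c d, IsFloat p (emin - kb) x :=
    fun x hx => isFloat_of_emin_le (by omega) (GB x hx)
  have htpS : ∀ x ∈ twoTwoProdDiff tp fl a b c d,
      (tp x z).1 = fl (x * z) ∧ (tp x z).1 + (tp x z).2 = x * z := fun x hx =>
    let h := htp' x z (GB x hx) ⟨Mb, kb, hMb, hkb, hrep⟩
    ⟨h.1, h.2.1⟩
  obtain ⟨hW, hS, hF, hne, hZ, hL⟩ :=
    scaleExpansionZeroElim_spec hp hfl hfl2 hrep hMb FB heU WB htpS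
  refine ⟨hW, by rw [orient3dTerm, hS, SB]; ring, hF, hne, hZ, ?_⟩
  rw [orient3dTerm]; rw [LB] at hL; exact le_trans hL (by norm_num)

/-- **THEOREM (ORIENT3D's stage-B expansion is an exact W-expansion).**  Let `p ≥ 4`, `fl` a
round-to-nearest whose roundoff lies 2-below its result (e.g. ties-to-even), the nine differences
in `F(p, e₀)` with `2e₀ ≥ emin` and `3e₀ ≥ emin`, and `tp` a two-product error-free on `F(p, e₀)²`
and on `F(p, 2e₀) × F(p, e₀)`.  Then `orient3dB` is a NONEMPTY weakly nonoverlapping expansion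
(hence nonoverlapping and increasing) of at most 24 floats, all nonzero unless it is `⟨0⟩`, whose
sum is `orient3dDetB` EXACTLY. -/
theorem orient3dB_spec (hp : 4 ≤ p) (hfl : IsRoundNearest p emin fl) (hfl2 : RoundoffBelow 2 fl)
    {e₀ : ℤ} (h2 : emin ≤ e₀ + e₀) (h3 : emin ≤ e₀ + e₀ + e₀) {tp : ℚ → ℚ → ℚ × ℚ}
    (htp : ∀ x y, IsFloat p e₀ x → IsFloat p e₀ y → ExactTwoProd p emin fl tp x y)
    (htp' : ∀ x y, IsFloat p (e₀ + e₀) x → IsFloat p e₀ y → ExactTwoProd p emin fl tp x y)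
    {xa ya za xb yb zb xc yc zc : ℚ} (hxa : IsFloat p e₀ xa) (hya : IsFloat p e₀ ya)
    (hza : IsFloat p e₀ za) (hxb : IsFloat p e₀ xb) (hyb : IsFloat p e₀ yb)
    (hzb : IsFloat p e₀ zb) (hxc : IsFloat p e₀ xc) (hyc : IsFloat p e₀ yc)
    (hzc : IsFloat p e₀ zc) :
    IsWeakExpansion (orient3dB tp fl xa ya za xb yb zb xc yc zc) ∧
      (orient3dB tp fl xa ya za xb yb zb xc yc zc).sum = orient3dDetB xa ya za xb yb zb xc yc zc ∧
      (∀ x ∈ orient3dB tp fl xa ya za xb yb zb xc yc zc, IsFloat p emin x) ∧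
      orient3dB tp fl xa ya za xb yb zb xc yc zc ≠ [] ∧
      ((∀ x ∈ orient3dB tp fl xa ya za xb yb zb xc yc zc, x ≠ 0) ∨
        orient3dB tp fl xa ya za xb yb zb xc yc zc = [0]) ∧
      (orient3dB tp fl xa ya za xb yb zb xc yc zc).length ≤ 24 := by
  have hp1 : 1 ≤ p := le_trans (by norm_num) hp
  obtain ⟨W1, S1, F1, -, -, L1⟩ :=
    orient3dTerm_spec hp1 hfl hfl2 h2 h3 htp htp' hxb hyc hxc hyb hza
  obtain ⟨W2, S2, F2, -, -, L2⟩ :=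
    orient3dTerm_spec hp1 hfl hfl2 h2 h3 htp htp' hxc hya hxa hyc hzb
  obtain ⟨W3, S3, F3, -, -, L3⟩ :=
    orient3dTerm_spec hp1 hfl hfl2 h2 h3 htp htp' hxa hyb hxb hya hzc
  obtain ⟨W12, S12, F12, -, -, L12⟩ := fastExpansionSumZeroElim_spec hp hfl hfl2 F1 W1 F2 W2
  obtain ⟨W, S, Fl, N, Z, L⟩ := fastExpansionSumZeroElim_spec hp hfl hfl2 F12 W12 F3 W3
  refine ⟨W, ?_, Fl, N, Z, ?_⟩
  · show (fastExpansionSumZeroElim fl _ _).sum = _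
    rw [S, S12, S1, S2, S3, orient3dDetB]
  · show (fastExpansionSumZeroElim fl _ _).length ≤ 24
    refine le_trans L ?_
    have := le_trans L12 (max_le_max (add_le_add L1 L2) le_rfl)
    omega

/-- **The sign of `B` from the expansion** (Shewchuk's §2.8 tests on the zero-eliminated
nonoverlapping expansion): the LAST component of `orient3dB` decides `B > 0`, `B < 0`, and
`B = 0 ↔ orient3dB = ⟨0⟩`.  (Stage B of the C code uses `estimate` instead; this is the exact
information the expansion carries.) -/
theorem orient3dB_sign (hp : 4 ≤ p) (hfl : IsRoundNearest p emin fl) (hfl2 : RoundoffBelow 2 fl)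
    {e₀ : ℤ} (h2 : emin ≤ e₀ + e₀) (h3 : emin ≤ e₀ + e₀ + e₀) {tp : ℚ → ℚ → ℚ × ℚ}
    (htp : ∀ x y, IsFloat p e₀ x → IsFloat p e₀ y → ExactTwoProd p emin fl tp x y)
    (htp' : ∀ x y, IsFloat p (e₀ + e₀) x → IsFloat p e₀ y → ExactTwoProd p emin fl tp x y)
    {xa ya za xb yb zb xc yc zc : ℚ} (hxa : IsFloat p e₀ xa) (hya : IsFloat p e₀ ya)
    (hza : IsFloat p e₀ za) (hxb : IsFloat p e₀ xb) (hyb : IsFloat p e₀ yb)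
    (hzb : IsFloat p e₀ zb) (hxc : IsFloat p e₀ xc) (hyc : IsFloat p e₀ yc)
    (hzc : IsFloat p e₀ zc) :
    ∃ hD : orient3dB tp fl xa ya za xb yb zb xc yc zc ≠ [],
      (0 < orient3dDetB xa ya za xb yb zb xc yc zc ↔
          0 < (orient3dB tp fl xa ya za xb yb zb xc yc zc).getLast hD) ∧
        (orient3dDetB xa ya za xb yb zb xc yc zc < 0 ↔
          (orient3dB tp fl xa ya za xb yb zb xc yc zc).getLast hD < 0) ∧
        (orient3dDetB xa ya za xb yb zb xc yc zc = 0 ↔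
          orient3dB tp fl xa ya za xb yb zb xc yc zc = [0]) := by
  obtain ⟨hW, hS, hF, hne, hZ, -⟩ :=
    orient3dB_spec hp hfl hfl2 h2 h3 htp htp' hxa hya hza hxb hyb hzb hxc hyc hzc
  refine ⟨hne, ?_⟩
  rw [← hS]
  rcases hZ with hnz | h0
  · obtain ⟨h1, h2, h3⟩ :=
      sign_sum_of_getLast_ne_zero hF hW.isExpansion hne (hnz _ (List.getLast_mem hne))
    refine ⟨h1, h2, ⟨fun h => absurd h h3, fun h => ?_⟩⟩
    exfalso
    rw [h] at hnz
    exact hnz 0 (List.mem_singleton_self 0) rfl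
  · have key : ∀ (L : List ℚ) (h : L ≠ []), L = [0] → L.getLast h = 0 ∧ L.sum = 0 := by
      rintro L h rfl; exact ⟨rfl, by simp⟩
    obtain ⟨hl, hs0⟩ := key _ hne h0
    rw [hl, hs0]
    exact ⟨Iff.rfl, Iff.rfl, ⟨fun _ => h0, fun _ => rfl⟩⟩

/-! ## Instances: FMA two-product; Dekker two-product -/

/-- **Stage-B expansion with the FMA two-product** (`2Prod_FMA`, any `RoundoffBelow 2`
round-to-nearest, `p ≥ 4`): exact W-expansion for differences in `F(p, e₀)`, `3e₀ ≥ emin`,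
`2e₀ ≥ emin`. -/
theorem orient3dB_fma_spec (hp : 4 ≤ p) (hfl : IsRoundNearest p emin fl) (hfl2 : RoundoffBelow 2 fl)
    {e₀ : ℤ} (h2 : emin ≤ e₀ + e₀) (h3 : emin ≤ e₀ + e₀ + e₀)
    {xa ya za xb yb zb xc yc zc : ℚ} (hxa : IsFloat p e₀ xa) (hya : IsFloat p e₀ ya)
    (hza : IsFloat p e₀ za) (hxb : IsFloat p e₀ xb) (hyb : IsFloat p e₀ yb)
    (hzb : IsFloat p e₀ zb) (hxc : IsFloat p e₀ xc) (hyc : IsFloat p e₀ yc)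
    (hzc : IsFloat p e₀ zc) :
    IsWeakExpansion (orient3dB (twoProdFMA fl) fl xa ya za xb yb zb xc yc zc) ∧
      (orient3dB (twoProdFMA fl) fl xa ya za xb yb zb xc yc zc).sum =
        orient3dDetB xa ya za xb yb zb xc yc zc ∧
      (∀ x ∈ orient3dB (twoProdFMA fl) fl xa ya za xb yb zb xc yc zc, IsFloat p emin x) ∧
      orient3dB (twoProdFMA fl) fl xa ya za xb yb zb xc yc zc ≠ [] ∧
      (orient3dB (twoProdFMA fl) fl xa ya za xb yb zb xc yc zc).length ≤ 24 := by
  have hp1 : 1 ≤ p := le_trans (by norm_num) hp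
  obtain ⟨W, S, F, N, -, L⟩ := orient3dB_spec hp hfl hfl2 h2 h3
    (fun x y hx hy => exactTwoProd_twoProdFMA₂ hp1 hfl h2 hx hy)
    (fun x y hx hy => exactTwoProd_twoProdFMA₂ hp1 hfl h3 hx hy) hxa hya hza hxb hyb hzb hxc hyc hzc
  exact ⟨W, S, F, N, L⟩

/-- **Stage-B expansion with Shewchuk's TWO-PRODUCT** (Dekker, split point `s`, `p ≤ 2s ≤ p + 1`,
rounding odd and `RoundoffBelow 2`, `p ≥ 4`) in Theorem 18's no-underflow regime for products of a
difference resp. a block component and a difference: `e₀ ≥ emin + p − 1`,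
`2e₀ ≥ emin + 2p − 1`, `3e₀ ≥ emin + 2p − 1`. -/
theorem orient3dB_dekker_spec (hp : 4 ≤ p) {s : ℕ} (hs2 : p ≤ 2 * s) (hs2' : 2 * s ≤ p + 1)
    (hfl : IsRoundNearest p emin fl) (hodd : ∀ t, fl (-t) = -fl t) (hfl2 : RoundoffBelow 2 fl)
    {e₀ : ℤ} (h1 : emin + p - 1 ≤ e₀) (h2 : emin + 2 * p - 1 ≤ e₀ + e₀)
    (h3 : emin + 2 * p - 1 ≤ e₀ + e₀ + e₀)
    {xa ya za xb yb zb xc yc zc : ℚ} (hxa : IsFloat p e₀ xa) (hya : IsFloat p e₀ ya)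
    (hza : IsFloat p e₀ za) (hxb : IsFloat p e₀ xb) (hyb : IsFloat p e₀ yb)
    (hzb : IsFloat p e₀ zb) (hxc : IsFloat p e₀ xc) (hyc : IsFloat p e₀ yc)
    (hzc : IsFloat p e₀ zc) :
    IsWeakExpansion (orient3dB (twoProduct fl s) fl xa ya za xb yb zb xc yc zc) ∧
      (orient3dB (twoProduct fl s) fl xa ya za xb yb zb xc yc zc).sum =
        orient3dDetB xa ya za xb yb zb xc yc zc ∧
      (∀ x ∈ orient3dB (twoProduct fl s) fl xa ya za xb yb zb xc yc zc, IsFloat p emin x) ∧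
      orient3dB (twoProduct fl s) fl xa ya za xb yb zb xc yc zc ≠ [] ∧
      (orient3dB (twoProduct fl s) fl xa ya za xb yb zb xc yc zc).length ≤ 24 := by
  have h2' : emin ≤ e₀ + e₀ := by omega
  have h3' : emin ≤ e₀ + e₀ + e₀ := by omega
  obtain ⟨W, S, F, N, -, L⟩ := orient3dB_spec hp hfl hfl2 h2' h3'
    (fun x y hx hy => exactTwoProd_twoProduct₂ hp hs2 hs2' hfl hodd h1 h1 h2 hx hy)
    (fun x y hx hy => exactTwoProd_twoProduct₂ hp hs2 hs2' hfl hodd (by omega) h1 h3 hx hy)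
    hxa hya hza hxb hyb hzb hxc hyc hzc
  exact ⟨W, S, F, N, L⟩

end Summit.Ventures.CertifiedArithmetic.Expansions
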